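import Summits.AnomalousDissipation.AnomalousDissipation.Theorems.SolenoidalFractalHomogenisationLagrangianStepCellClauseCutsFamily
import Summits.AnomalousDissipation.AnomalousDissipation.Theorems.SolenoidalFractalHomogenisationLagrangianStepOneLevelSplitDefs
import Literature.Analysis.FluidPDE.PassiveVectorTensorDistorted
import Literature.Analysis.FluidPDE.LagrangianLatticeCarrier
import Mathlib.Analysis.InnerProductSpace.Adjoint
import HarnessLib

/-!
# (V_mod) DRAFT — the MODULATED cell clause in LOSS CURRENCY, and the glue it is meant to feed (lead-k1l-onelevel-p1 g4, 2026-08-29T03:xxZ)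

Cruxes WORKFILE (typed, elaborating; the one `theorem` is a `sorry`d GLUE TARGET, not a claim).  Tenure RULING D26-10: Z7γ line of record = γ2
(registry-level modulated cell clause, certified like (V)); lead to TYPE the clause and the Theorems-side reduction.  This is the draft for the
tenure / ad-lit g28 / p5 to critique BEFORE a `…Defs` file goes to the review lane.  Memo: `Lines/onelevel-L10-Vmod-currency.md`.

## Design (memo L10)

* CURRENCY.  Not Fourier/N-weights (phase scrambling, L9 §3(a)(b)) but the two INTRINSIC quadratic losses of the COARSE member:
  forward `q_T(x) = ‖x‖² − ‖T x‖²` and adjoint `q_T^*(ζ) = ‖ζ‖² − ‖T† ζ‖²` (`T†` the Hilbert adjoint on `V2`).  Both are frame-invariant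
  (composition with a measure-preserving map is unitary), nonnegative quadratic forms (`q(a+b) ≤ 2q(a)+2q(b)`), and COMPOSE across a frame
  reset: with `U−T = (U₂−T₂)U₁ + T₂(U₁−T₁)` one gets `q*_{1}(T₂†y) ≤ q*_{12}(y)`, `q_{T₂}(U₁x) ≤ 2q_{T₁₂}(x) + 2‖(U₁−T₁)x‖²` and the clause
  tested against `ζ := (U₁−T₁)x` itself gives `‖(U₁−T₁)x‖ ≤ η √q_{T₁}(x)` — so two windows cost a factor `(2+2η²)`, nothing else.
* STATEMENT (`SlowVectorClauseModE`).  For every member of the (V)-family (`ν, n, 𝔸` as in `SlowVectorClauseF`), every modulation datum `G`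
  (`IsModulation θ Tw nC G`: `G(0)=1`, `|G−1| ≤ θ`, Piola rows, `det = 1`, smooth in `y` with `|∇G| ≤ θ·nC`, Lipschitz in `t`), and every pair
  of DISTORTED propagators (`IsDistortedPropagator`, the `IsPropagator` spec over the tree class `IsWeakTensorPassiveVectorDistortedOn`) of the
  cell member (drift `cellField`, tensor `(1/n²)𝔸`, distortion `G`) and of the coarse member (drift `0`, tensor `(1/n²)(𝔸 + (c/ν)Φ_ν((1/ν)𝔸))`,
  distortion `G`): for ALL `x, ζ ∈ V2`,
  `|⟪(U s t − T s t)x, ζ⟫| ≤ η · √(q_{T s t}(x)) · √(q*_{T s t}(ζ))`, `η = C(C(ν^σ + (⌈K/ν⌉/n)^σ + θ^σ + (nC/n)^σ) + ((M·Wp/ν)/(t−s))^σ)`.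
  For `G ≡ 1` this is the FLAT loss-currency form of (BIL) (all data: slow×slow = (V), the rest = (F)/(H)-type inputs); the exact error
  functional is the certifiers' call — the Prop takes `C, σ` as parameters exactly like (V).
* GLUE (target `cellInputs_bilinear_of_mod`, sorried here): §9z ⇐ (V_modE) [frame pair = Eulerian `(U, T_ad)` by measure preservation]
  + Z7β [`T_ad − T` relative `O(θ)` in loss currency; `q_{T_ad} ≲ q_T`; `q_T ≤ C·N²`, `q*_T ≤ C·N²` for the coarse Eulerian propagator]
  + Z7α [existence of `T_ad` and of the frame-conjugate distorted propagators] + Z7δ [slack bookkeeping].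
* REGISTRY ASK (tenure): §9/§9z let the window `[jr, s']` span TWO refresh windows (`r ≤ s'−jr ≤ 2r`).  In loss currency this is harmless
  (composition above); in N-currency it is not.  So the glue converts to N-currency only ONCE, at the end.
-/

set_option linter.dupNamespace false

noncomputable section

namespace Summit.AnomalousDissipation.AnomalousDissipation.Cruxes.LagrangianRenormalisationStepDesign.OneLevelSplit.VMod

open Literature.Analysis Literature.Analysis.FluidPDE Literature.Analysis.FunctionSpaces
open MeasureTheory Set Filter UnitAddTorus
open scoped ENNReal NNReal InnerProductSpace
open Summit.AnomalousDissipation.AnomalousDissipation.Theorems.SolenoidalFractalHomogenisation.LagrangianStep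

/-! ## §1 Modulation data -/

/-- **A modulation datum on a window of (cell-)time length `Tw`**: a matrix field `G(t,y)` (the inverse Jacobian `(DX)⁻¹` of the coarse window
flow, read in the frame and in cell units) with `G(0) = 1` (frame reset at the window's left end), `θ`-close to the identity, unimodular with
divergence-free columns (Piola: `∇·(G v) = Σ G_{ci} ∂_c v_i`, so the distorted constraint is a first-order operator), smooth in `y` with gradient
`≤ θ·nC` (`nC` = the modulation wavenumber, `N_m` in the cell units of level `m+1`), and Lipschitz in `t`. -/
structure IsModulation (θ Tw nC : ℝ) (G : ℝ → UnitAddTorus (Fin 3) → Matrix (Fin 3) (Fin 3) ℝ) : Prop where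
  init : ∀ y, G 0 y = 1
  near_one : ∀ t ∈ Icc 0 Tw, ∀ y i j, |G t y i j - (1 : Matrix (Fin 3) (Fin 3) ℝ) i j| ≤ θ
  det_one : ∀ t ∈ Icc 0 Tw, ∀ y, (G t y).det = 1
  piola : ∀ t ∈ Icc 0 Tw, ∀ i, Torus.IsDivFree (fun y => (WithLp.toLp 2 fun c => G t y c i : EuclideanSpace ℝ (Fin 3)))
  smooth : ∀ t ∈ Icc 0 Tw, ∀ i j, Torus.IsSmooth (fun y => G t y i j)
  grad_le : ∀ t ∈ Icc 0 Tw, ∀ y i j c, |Torus.partialDeriv c (fun y => G t y i j) y| ≤ θ * nC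
  lipschitz : ∃ L : ℝ≥0, ∀ y i j, LipschitzOnWith L (fun t => G t y i j) (Icc 0 Tw)

/-! ## §2 Distorted propagators and the two losses -/

/-- **The propagator spec over the DISTORTED class** (`IsPropagator` with `IsWeakTensorPassiveVectorOn ↦ IsWeakTensorPassiveVectorDistortedOn`
and the divergence constraints read through `G`): contraction, cocycle, identity at `s = t` on `G(s)`-solenoidal data, `G(t)`-solenoidal range,
vanishing on the orthogonal complement of the `G(s)`-solenoidal classes, weak continuity, and representation of every distorted weak solution. -/
structure IsDistortedPropagator (Tw : ℝ) (𝔸 : Torus.Visc4 (Fin 3)) (b : ℝ → VF)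
    (G : ℝ → UnitAddTorus (Fin 3) → Matrix (Fin 3) (Fin 3) ℝ) (U : ℝ → ℝ → (V2 →L[ℝ] V2)) : Prop where
  norm_le : ∀ (s t : ℝ) (y : V2), ‖U s t y‖ ≤ ‖y‖
  comp : ∀ (s t r : ℝ), 0 ≤ s → s ≤ t → t ≤ r → r ≤ Tw → ∀ y : V2, U t r (U s t y) = U s r y
  self_of_divFree : ∀ (s : ℝ), 0 ≤ s → s ≤ Tw → ∀ y : V2, Torus.IsWeaklyDivFree (Torus.distort (G s) (y : VF)) → U s s y = y
  divFree : ∀ (s t : ℝ) (y : V2), Torus.IsWeaklyDivFree (Torus.distort (G t) ((U s t y : V2) : VF))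
  eq_zero_of_orth : ∀ (s t : ℝ) (y : V2),
    (∀ z : V2, Torus.IsWeaklyDivFree (Torus.distort (G s) (z : VF)) → ⟪y, z⟫_ℝ = 0) → U s t y = 0
  continuousOn : ∀ (s : ℝ), 0 ≤ s → s ≤ Tw → ∀ y z : V2, ContinuousOn (fun t => ⟪U s t y, z⟫_ℝ) (Icc s Tw)
  repr : ∀ (s : ℝ), 0 ≤ s → s < Tw → ∀ (φ : VF) (hφ : MemLp φ 2 volume), Torus.IsWeaklyDivFree (Torus.distort (G s) φ) →
    ∀ w : ℝ → VF, Torus.IsWeakTensorPassiveVectorDistortedOn 0 (Tw - s) 𝔸 (fun τ => b (s + τ)) (fun τ => G (s + τ)) φ w →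
      ∀ᵐ τ ∂(volume.restrict (Ioo 0 (Tw - s))), ∃ hτ : MemLp (w τ) 2 volume, hτ.toLp (w τ) = U s (s + τ) (hφ.toLp φ)

/-- The FORWARD LOSS of a window map: `q_T(x) = ‖x‖² − ‖T x‖²` (for a contraction: the energy dissipated; `≥ 0`, a quadratic form). -/
def lossFwd (T : V2 →L[ℝ] V2) (x : V2) : ℝ := ‖x‖ ^ 2 - ‖T x‖ ^ 2

/-- The ADJOINT LOSS of a window map: `q*_T(ζ) = ‖ζ‖² − ‖T† ζ‖²`, `T†` the Hilbert adjoint on `V2` (the energy the ADJOINT problem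
dissipates from the test datum `ζ`; intrinsic — no Fourier weights, no frame). -/
def lossAdj (T : V2 →L[ℝ] V2) (ζ : V2) : ℝ := ‖ζ‖ ^ 2 - ‖ContinuousLinearMap.adjoint T ζ‖ ^ 2

/-! ## §3 The modulated clause in loss currency -/

/-- **(V_modE) — the MODULATED slow-vector clause, loss currency (DRAFT).**  For every member `(ν, n, 𝔸)` of the (V)-family
(`SlowVectorClauseF`'s binders: quasi-static `ν < ν₀`, `OddSmall 𝔸 (νβ)`, `NearIso 𝔸 (ν lo/λ) (ν hi λ)` for some `λ ∈ [1, Λ]`, resolution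
`⌈K/ν⌉ ≤ n`), every distortion `θ ≤ θ₁`, modulation ratio `nC ≤ ϱ₁·n`, window `Tw > 0`, modulation datum `G`, and every pair of distorted
propagators — `U` of the CELL member (drift `cellField W M hM ν n`, tensor `(1/n²)𝔸`, distortion `G`) and `T` of the COARSE member (no drift,
tensor `(1/n²)(𝔸 + (c/ν)Φ_ν((1/ν)𝔸))`, distortion `G`) — and ALL data `x, ζ ∈ V2`, `0 ≤ s < t ≤ Tw`:
`|⟪(U s t − T s t) x, ζ⟫| ≤ η · √(q_{T s t}(x)) · √(q*_{T s t}(ζ))`,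
`η = C·(C·(ν^σ + (⌈K/ν⌉/n)^σ + θ^σ + (nC/n)^σ) + ((M·Wp/ν)/(t − s))^σ)`.
(`G ≡ 1`: the flat loss-currency (BIL); the error functional's exact shape is the certifiers' call.) -/
def SlowVectorClauseModE {k : ℕ} (W : LatticeShear.LatticeWord k) (M : ℝ) (hM : 0 < M) (c : ℝ)
    (Φ : ℝ → Torus.Visc4 (Fin 3) → Torus.Visc4 (Fin 3)) (lo hi Λ β σ C ν₀ K θ₁ ϱ₁ : ℝ) : Prop :=
  ∀ ν, ∀ hν : ν ∈ Set.Ioo 0 ν₀, ∀ n : ℕ, (⌈K / ν⌉₊ : ℝ) ≤ n → ∀ 𝔸 : Torus.Visc4 (Fin 3),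
    Torus.OddSmall 𝔸 (ν * β) → (∃ lam ∈ Set.Icc (1:ℝ) Λ, Torus.NearIso 𝔸 (ν * (lo / lam)) (ν * (hi * lam))) →
    ∀ θ ∈ Set.Icc 0 θ₁, ∀ nC : ℝ, 0 ≤ nC → nC ≤ ϱ₁ * n → ∀ Tw > (0:ℝ),
    ∀ G : ℝ → UnitAddTorus (Fin 3) → Matrix (Fin 3) (Fin 3) ℝ, IsModulation θ Tw nC G →
    ∀ U T : ℝ → ℝ → (V2 →L[ℝ] V2),
      IsDistortedPropagator Tw ((1 / (n:ℝ) ^ 2) • 𝔸) (cellField W M hM ν hν.1 n) G U →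
      IsDistortedPropagator Tw ((1 / (n:ℝ) ^ 2) • (𝔸 + (c / ν) • Φ ν ((1 / ν) • 𝔸))) (fun _ _ => 0) G T →
    ∀ s t : ℝ, 0 ≤ s → s < t → t ≤ Tw → ∀ x ζ : V2,
      |⟪U s t x - T s t x, ζ⟫_ℝ|
        ≤ (C * (C * (ν ^ σ + ((⌈K / ν⌉₊ : ℝ) / n) ^ σ + θ ^ σ + (nC / n) ^ σ) + ((M * W.period / ν) / (t - s)) ^ σ))
          * Real.sqrt (lossFwd (T s t) x) * Real.sqrt (lossAdj (T s t) ζ)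

/-! ## §4 Loss-currency composition across a frame reset — PROVED: `Theorems/…LagrangianStepLossCurrency.lean` (p690895),
`LossCurrency.lossBound_comp` (generic real Hilbert space, inline losses; also `norm_adjoint_le`, `loss_add_le`, `norm_sub_le_of_lossBound`, …).
The text below is its `V2` instance, kept as the record of what the glue uses. -/

/-- Composition lemma (PROVED as `LossCurrency.lossBound_comp`, p690895): if on `[s, r']` and `[r', t]` the pairs `(U₁,T₁)`, `(U₂,T₂)` satisfy the
loss-currency bound with constants `η₁, η₂` and all four maps are contractions, then `U₂U₁ − T₂T₁` satisfies it on `[s,t]` with constant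
`η₁·√(2 + 2η₁²)… ≤ (η₁ + η₂)·√(2+2η₁²)` against the losses of `T₂T₁` (`q*_{T₁}(T₂†y) ≤ q*_{T₂T₁}(y)`, `q_{T₂}(U₁x) ≤ 2q_{T₂T₁}(x) + 2η₁² q_{T₁}(x)`,
`q_{T₁} ≤ q_{T₂T₁}`). -/
def lossCompose_text : Prop :=
  ∀ (U₁ T₁ U₂ T₂ : V2 →L[ℝ] V2) (η₁ η₂ : ℝ), 0 ≤ η₁ → 0 ≤ η₂ →
    (∀ y, ‖U₁ y‖ ≤ ‖y‖) → (∀ y, ‖T₁ y‖ ≤ ‖y‖) → (∀ y, ‖U₂ y‖ ≤ ‖y‖) → (∀ y, ‖T₂ y‖ ≤ ‖y‖) →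
    (∀ x ζ : V2, |⟪U₁ x - T₁ x, ζ⟫_ℝ| ≤ η₁ * Real.sqrt (lossFwd T₁ x) * Real.sqrt (lossAdj T₁ ζ)) →
    (∀ x ζ : V2, |⟪U₂ x - T₂ x, ζ⟫_ℝ| ≤ η₂ * Real.sqrt (lossFwd T₂ x) * Real.sqrt (lossAdj T₂ ζ)) →
    ∀ x ζ : V2, |⟪U₂ (U₁ x) - T₂ (T₁ x), ζ⟫_ℝ|
      ≤ (η₁ + η₂) * Real.sqrt (2 + 2 * η₁ ^ 2) * Real.sqrt (lossFwd (T₂.comp T₁) x) * Real.sqrt (lossAdj (T₂.comp T₁) ζ)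

end Summit.AnomalousDissipation.AnomalousDissipation.Cruxes.LagrangianRenormalisationStepDesign.OneLevelSplit.VMod

end
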